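import Summits.QuantumAdvantage.QuantumAdvantage.Theorems.CouplingDialConst

/-!
# CouplingDial (part F, bounded index) — `N_{c+1} ⟺ T` for every constant `c` (`npow`/`minv`, `mv_mul_minv`, `acRealOver_strFunK`, `constNilRung_iff`)

Tree twin of node «CouplingDial» rev 4 §12 (cut verbatim).  A unipotent coupling `L = 𝟙 ⊕ N` of index `≤ c+1` has `L⁻¹ = Σ_{j≤c} N^j`
(`mmul`/`nmat`/`npow`/`minv`, `mv_npow`, telescoping `tele_zmod2`, inverse laws `mv_mul_minv`/`mv_minv_mul`); entries of `N^j` off the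
code take `j` parity-of-AND layers (`acRealOver_npow`, sizes `SP`), those of `L⁻¹` one more (`acRealOver_minv`, `SM`), the composed table
layer of part E on top (`acRealOver_redTabM`, `strFunK`, `acRealOver_strFunK`, `kPoly`); `Φ_L(F,G) = Φ_𝟙(F, G∘L⁻¹)` (`value_compL_of_inverse`);
a table-level signer of the solo slice separates every bounded-index slice (`nilSlice_const_mem_of_signer`), hence
`rungANonuniform_of_constNilRung`, ★ `constNilRung_iff : ∀ c, ConstNilRung c ↔ AnfPresentation.RungANonuniform`, `dial_summary_rev4`.
-/

set_option linter.dupNamespace false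

noncomputable section

namespace Summit.QuantumAdvantage.QuantumAdvantage.Theorems.CouplingDial

open Finset
open Literature.Computability.Complexity
open Literature.Computability.QuantumComplexity
open Literature.Computability.MetaComplexity
open _root_.Computability (encodeNat)
open Summit.QuantumAdvantage.QuantumAdvantage.Theorems.HintDial
open Summit.QuantumAdvantage.QuantumAdvantage.Theorems.HintDial.Automaton
open Summit.QuantumAdvantage.QuantumAdvantage.Theorems.GapDial.Automaton (blockDiag blockDiag_left blockDiag_right
  mv_blockDiag bd_zero_left EE bxor_append)
open Summit.QuantumAdvantage.QuantumAdvantage.Theorems.FlatDial (clen length_encode_eq_clen clen_injective clen_lt_clen le_clen)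
open Summit.QuantumAdvantage.QuantumAdvantage.Theses.AnfPresentation (RungANonuniform RungA LiftA AnfEquiv NearExactIsExact
  SignedExactSliceIsLift)
open CubicForm (bit)
open DerivativeWalsh (W)
open BuzetChailloux (bxor zeroVec)

/-! ## §12 ★★★ `N_{c+1} ⟺ T` FOR EVERY CONSTANT `c`: BOUNDED-INDEX COUPLINGS ARE FREE (critic row 71v14 ask (1), in full)

A unipotent coupling `L = 𝟙 ⊕ N` of index `≤ c + 1` (`N^{c+1} = 0`) has `L⁻¹ = Σ_{j ≤ c} N^j` (telescoping over `𝔽₂`: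
`(𝟙 ⊕ N) · Σ_{j≤c} N^j = 𝟙 ⊕ N^{c+1}`; kernel: `mv_mul_minv`, `mv_minv_mul`).  The entries of `N^j`, READ FROM THE CODE, are computed
by `j` parity-of-AND layers (`acRealOver_npow`: depth `2j+1`, size `SP j = O(n^j)`), those of `L⁻¹` by one more parity
(`acRealOver_minv`: depth `2c+2`), and the cubic table of `G ∘ L⁻¹` (`compL G (minv L c)`, §11 `eval_compL`) by the §11 composition layer
on top (`acRealOver_redTabM`: depth `2c+6` per coordinate, polynomial size `ZP c`).  With `Φ_L(F, G) = Φ_𝟙(F, G ∘ L⁻¹)`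
(`value_compL_of_inverse`) a table-level signer of the solo slice separates `NilSlice (c+1)` (`nilSlice_const_mem_of_signer`), so
★ `constNilRung_iff : ∀ c, ConstNilRung c ↔ T` (`ConstNilRung c = N_{c+1}`): on the unipotency dial the
equivalence class of item 27991 contains EVERY CONSTANT INDEX, the theorem end starts at `n/6` (`nilRung_sixth`), and the open window is
exactly the super-constant, sub-linear indices — `W′ = N_{log₂ n + 1}` its first named notch (`dial_summary_rev4`).  The depth `2c + 6` of
the inversion layer is where constancy of `c` is used: for `c = ω(1)` the layer leaves `AC⁰[⊕]`. -/

section IndexConst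

open Summit.QuantumAdvantage.QuantumAdvantage.Theorems.FlatDial (tabN tabEquiv formOf pairOf tabOf pairOf_tabOf realisable signers
  rd pos pol ext rd_ext_encode pos_lt_clen tabN_le_clen tabN_eq acRealOver_parity acRealOver_and2 bit_parity
  signedSlice_not_mem_promiseLift_iff_no_signer length_encode_pairOf)

variable {n : ℕ}

/-! ### 12a Boolean matrix algebra: `N = L ⊕ 𝟙`, its powers, `Σ_{j≤c} N^j`, and the two-sided inverse law -/

/-- Boolean matrix product over `𝔽₂`. -/
def mmul (A B : Fin n → Fin n → Bool) : Fin n → Fin n → Bool := fun i j => bd (A i) fun l => B l j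

/-- `N := L ⊕ 𝟙` (entry = code literal with polarity `[i = j]`). -/
def nmat (L : Fin n → Fin n → Bool) : Fin n → Fin n → Bool := fun i j => xor (L i j) (dM i j)

/-- `N^j`. -/
def npow (L : Fin n → Fin n → Bool) : ℕ → (Fin n → Fin n → Bool)
  | 0 => dM
  | j + 1 => mmul (nmat L) (npow L j)

/-- `Σ_{j ≤ c} N^j` — the inverse of a unipotent `L` of index `≤ c + 1` — entries as parities. -/
def minv (L : Fin n → Fin n → Bool) (c : ℕ) : Fin n → Fin n → Bool := fun i a =>
  decide (Odd (GateFn.numOnes fun j : Fin (c + 1) => npow L j i a))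

/-- CouplingDialIndex helper `mv_mmul` (decomp-qadv land package; see the module docstring). -/
theorem mv_mmul (A B : Fin n → Fin n → Bool) (v : Fin n → Bool) : mv (mmul A B) v = mv A (mv B v) := by
  funext i
  apply bit_injective
  show bit (bd (mmul A B i) v) = bit (bd (A i) (mv B v))
  rw [bit_bd, bit_bd]
  have hB : ∀ l, bit (mv B v l) = ∑ j, bit (B l j) * bit (v j) := fun l => bit_bd _ _
  simp_rw [mmul, bit_bd, hB, Finset.sum_mul, Finset.mul_sum]
  rw [Finset.sum_comm]
  exact sum_congr rfl fun l _ => sum_congr rfl fun j _ => by ring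

/-- CouplingDialIndex helper `mv_nmat` (decomp-qadv land package; see the module docstring). -/
theorem mv_nmat (L : Fin n → Fin n → Bool) (v : Fin n → Bool) : mv (nmat L) v = ustep L v := by
  funext a
  show bd (bxor (L a) (sgl a)) v = xor (mv L v a) (v a)
  rw [Summit.QuantumAdvantage.QuantumAdvantage.Theorems.FlatDial.bd_bxor_left, bd_sgl_left]
  rfl

/-- CouplingDialIndex helper `mv_npow` (decomp-qadv land package; see the module docstring). -/
theorem mv_npow (L : Fin n → Fin n → Bool) (j : ℕ) (v : Fin n → Bool) : mv (npow L j) v = uiter L j v := by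
  induction j with
  | zero => exact mv_dM v
  | succ j ih => show mv (mmul (nmat L) (npow L j)) v = ustep L (uiter L j v); rw [mv_mmul, ih, mv_nmat]

/-- CouplingDialIndex helper `bit_mv_minv` (decomp-qadv land package; see the module docstring). -/
theorem bit_mv_minv (L : Fin n → Fin n → Bool) (c : ℕ) (v : Fin n → Bool) (i : Fin n) :
    bit (mv (minv L c) v i) = ∑ j : Fin (c + 1), bit (uiter L j v i) := by
  show bit (bd (minv L c i) v) = _
  rw [bit_bd]
  have hm : ∀ a, bit (minv L c i a) = ∑ j : Fin (c + 1), bit (npow L j i a) := fun a => bit_parity _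
  simp_rw [hm, Finset.sum_mul]
  rw [Finset.sum_comm]
  refine sum_congr rfl fun j _ => ?_
  rw [← mv_npow L j v]
  show _ = bit (bd (npow L j i) v)
  rw [bit_bd]

/-- CouplingDialIndex helper `two_eq_zero_zmod2` (decomp-qadv land package; see the module docstring). -/
private theorem two_eq_zero_zmod2 (x : ZMod 2) : x + x = 0 := by
  fin_cases x <;> decide

/-- `L = N ⊕ 𝟙` at the bit level: `(L w)_i = (N w)_i + w_i`. -/
theorem bit_mv_eq_ustep (L : Fin n → Fin n → Bool) (w : Fin n → Bool) (i : Fin n) :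
    bit (mv L w i) = bit (ustep L w i) + bit (w i) := by
  show bit (mv L w i) = bit (xor (mv L w i) (w i)) + bit (w i)
  rw [bit_xor, add_assoc, two_eq_zero_zmod2, add_zero]

/-- CouplingDialIndex helper `mv_eq_bxor_ustep` (decomp-qadv land package; see the module docstring). -/
theorem mv_eq_bxor_ustep (L : Fin n → Fin n → Bool) (v : Fin n → Bool) : mv L v = bxor (ustep L v) v := by
  funext i
  show mv L v i = xor (xor (mv L v i) (v i)) (v i)
  rw [Bool.xor_assoc, Bool.xor_self, Bool.xor_false]

/-- CouplingDialIndex helper `ustep_bxor` (decomp-qadv land package; see the module docstring). -/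
theorem ustep_bxor (L : Fin n → Fin n → Bool) (p q : Fin n → Bool) : ustep L (bxor p q) = bxor (ustep L p) (ustep L q) := by
  funext i
  show xor (mv L (bxor p q) i) (xor (p i) (q i)) = xor (xor (mv L p i) (p i)) (xor (mv L q i) (q i))
  rw [mv_bxor]
  show xor (xor (mv L p i) (mv L q i)) (xor (p i) (q i)) = _
  generalize mv L p i = a
  generalize mv L q i = b
  generalize p i = c
  generalize q i = d
  cases a <;> cases b <;> cases c <;> cases d <;> rfl

/-- CouplingDialIndex helper `uiter_bxor` (decomp-qadv land package; see the module docstring). -/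
theorem uiter_bxor (L : Fin n → Fin n → Bool) (j : ℕ) (p q : Fin n → Bool) :
    uiter L j (bxor p q) = bxor (uiter L j p) (uiter L j q) := by
  induction j with
  | zero => rfl
  | succ j ih =>
    show ustep L (uiter L j (bxor p q)) = bxor (ustep L (uiter L j p)) (ustep L (uiter L j q))
    rw [ih, ustep_bxor]

/-- CouplingDialIndex helper `uiter_mv` (decomp-qadv land package; see the module docstring). -/
theorem uiter_mv (L : Fin n → Fin n → Bool) (j : ℕ) (v : Fin n → Bool) :
    uiter L j (mv L v) = bxor (uiter L (j + 1) v) (uiter L j v) := by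
  rw [mv_eq_bxor_ustep, uiter_bxor, show ustep L v = uiter L 1 v from rfl, ← uiter_add]

/-- telescoping over `𝔽₂`. -/
theorem tele_zmod2 (f : ℕ → ZMod 2) (c : ℕ) : ∑ j : Fin (c + 1), (f (j + 1) + f j) = f (c + 1) + f 0 := by
  induction c with
  | zero => simp
  | succ c ih =>
    rw [Fin.sum_univ_castSucc]
    simp only [Fin.val_castSucc, Fin.val_last]
    rw [ih]
    have h2 := two_eq_zero_zmod2 (f (c + 1))
    linear_combination h2

/-- ★ `L · (Σ_{j≤c} N^j) = 𝟙` for `L` unipotent of index `≤ c + 1`. -/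
theorem mv_mul_minv {L : Fin n → Fin n → Bool} {c : ℕ} (hL : Unipotent L (c + 1)) (v : Fin n → Bool) :
    mv L (mv (minv L c) v) = v := by
  funext i
  apply bit_injective
  rw [bit_mv]
  simp_rw [bit_mv_minv, Finset.mul_sum]
  rw [Finset.sum_comm]
  have h1 : ∀ j : Fin (c + 1), ∑ a, bit (L i a) * bit (uiter L j v a) = bit (uiter L (j + 1) v i) + bit (uiter L j v i) :=
    fun j => by rw [← bit_mv]; exact bit_mv_eq_ustep L (uiter L j v) i
  rw [sum_congr rfl fun j _ => h1 j, tele_zmod2 (fun j => bit (uiter L j v i)) c, hL v]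
  show bit false + bit (v i) = bit (v i)
  rw [bit_false, zero_add]

/-- ★ `(Σ_{j≤c} N^j) · L = 𝟙` for `L` unipotent of index `≤ c + 1`. -/
theorem mv_minv_mul {L : Fin n → Fin n → Bool} {c : ℕ} (hL : Unipotent L (c + 1)) (v : Fin n → Bool) :
    mv (minv L c) (mv L v) = v := by
  funext i
  apply bit_injective
  rw [bit_mv_minv]
  have h1 : ∀ j : Fin (c + 1), bit (uiter L j (mv L v) i) = bit (uiter L (j + 1) v i) + bit (uiter L j v i) :=
    fun j => by rw [uiter_mv]; exact bit_xor _ _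
  rw [sum_congr rfl fun j _ => h1 j, tele_zmod2 (fun j => bit (uiter L j v i)) c, hL v]
  show bit false + bit (v i) = bit (v i)
  rw [bit_false, zero_add]

/-- ★ `Φ_𝟙(F, G ∘ M) = Φ_L(F, G)` whenever `M = L⁻¹` (substitute `y ↦ M y`). -/
theorem value_compL_of_inverse (I : CTriple) (M : Fin I.n → Fin I.n → Bool) (h₁ : ∀ y, mv I.L (mv M y) = y)
    (h₂ : ∀ y, mv M (mv I.L y) = y) : (⟨I.n, I.F, compL I.G M⟩ : CubicANFPair).value = I.cvalue := by
  unfold CTriple.cvalue CubicANFPair.value forrelation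
  congr 1
  refine sum_congr rfl fun x _ => ?_
  simp_rw [eval_compL]
  exact Fintype.sum_bijective (mv M) (Function.bijective_iff_has_inverse.mpr ⟨mv I.L, h₁, h₂⟩) _ _ fun y => by rw [h₁]

/-! ### 12b The inversion layer as an `AC⁰[⊕]` circuit over the code -/

/-- reading the coupling matrix off a code string. -/
def matRd (n N : ℕ) (y : Fin N → Bool) : Fin n → Fin n → Bool := fun a b =>
  ext y (2 * ((finProdFinEquiv (a, b) : Fin (n * n)) : ℕ))

/-- CouplingDialIndex helper `matRd_encode` (decomp-qadv land package; see the module docstring). -/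
theorem matRd_encode (I : CTriple) : matRd I.n I.encode.length I.encode.get = I.L :=
  funext fun a => funext fun b => ext_encode_mat I a b

/-- size of a level-`j` power entry. -/
def SP : ℕ → Polynomial ℕ
  | 0 => 1
  | j + 1 => (Polynomial.X + 1) * (2 * SP j + 1) + 1

/-- CouplingDialIndex helper `SP_eval_zero` (decomp-qadv land package; see the module docstring). -/
theorem SP_eval_zero (n : ℕ) : (SP 0).eval n = 1 := by simp [SP]

/-- CouplingDialIndex helper `SP_eval_succ` (decomp-qadv land package; see the module docstring). -/
theorem SP_eval_succ (j n : ℕ) : (SP (j + 1)).eval n = (n + 1) * (2 * (SP j).eval n + 1) + 1 := by simp [SP]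

/-- CouplingDialIndex helper `one_le_SP_eval` (decomp-qadv land package; see the module docstring). -/
theorem one_le_SP_eval (j n : ℕ) : 1 ≤ (SP j).eval n := by
  cases j with
  | zero => rw [SP_eval_zero]
  | succ j => rw [SP_eval_succ]; exact Nat.le_add_left 1 _

/-- CouplingDialIndex helper `SP_eval_mono` (decomp-qadv land package; see the module docstring). -/
theorem SP_eval_mono (n : ℕ) : Monotone fun j => (SP j).eval n :=
  monotone_nat_of_le_succ fun j => by
    show (SP j).eval n ≤ (SP (j + 1)).eval n
    rw [SP_eval_succ]; nlinarith

/-- size of an `L⁻¹` entry. -/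
def SM (c : ℕ) : Polynomial ℕ := Polynomial.C (c + 1) * SP c + 1

/-- CouplingDialIndex helper `SM_eval` (decomp-qadv land package; see the module docstring). -/
theorem SM_eval (c n : ℕ) : (SM c).eval n = (c + 1) * (SP c).eval n + 1 := by simp [SM]

/-- ★ entries of `N^j` off the code: depth `2j + 1`, size `SP j (n)` (`j` parity-of-AND layers). -/
theorem acRealOver_npow {n N : ℕ} (hmat : ∀ a b : Fin n, 2 * ((finProdFinEquiv (a, b) : Fin (n * n)) : ℕ) < N) (j : ℕ) (i a : Fin n) :
    ACRealOver (accBasis 2) (fun y : Fin N → Bool => npow (matRd n N y) j i a) (2 * j + 1) ((SP j).eval n) := by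
  induction j generalizing i with
  | zero =>
    exact ((acRealOver_const (acBasis_subset_accBasis 2) (dM i a)).mono (by norm_num) (by rw [SP_eval_zero])).congr fun y => rfl
  | succ j ih =>
    have hlit : ∀ l : Fin n, ACRealOver (accBasis 2) (fun y : Fin N → Bool => nmat (matRd n N y) i l) 1 1 := fun l =>
      (acRealOver_evalLit 2 (Sum.inr (dM i l, ⟨_, hmat i l⟩) : Lit N)).congr fun y => by
        show xor (dM i l) (y ⟨_, hmat i l⟩) = xor (ext y _) (dM i l)
        rw [Theorems.FlatDial.ext, dif_pos (hmat i l), Bool.xor_comm]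
    have hterm : ∀ l : Fin n, ACRealOver (accBasis 2)
        (fun y : Fin N → Bool => nmat (matRd n N y) i l && npow (matRd n N y) j l a) (2 * j + 1 + 1) (2 * (SP j).eval n + 1) :=
      fun l => acRealOver_and2 ((hlit l).mono (by omega) (one_le_SP_eval j n)) (ih l)
    refine ((acRealOver_parity hterm).mono (by omega) ?_).congr fun y => rfl
    rw [SP_eval_succ]
    exact Nat.add_le_add_right (Nat.mul_le_mul_right _ (Nat.le_succ n)) 1

/-- ★ entries of `Σ_{j≤c} N^j` off the code: depth `2c + 2`, size `SM c (n)`. -/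
theorem acRealOver_minv {n N : ℕ} (hmat : ∀ a b : Fin n, 2 * ((finProdFinEquiv (a, b) : Fin (n * n)) : ℕ) < N) (c : ℕ) (i a : Fin n) :
    ACRealOver (accBasis 2) (fun y : Fin N → Bool => minv (matRd n N y) c i a) (2 * c + 2) ((SM c).eval n) := by
  have hj : ∀ j : Fin (c + 1), ACRealOver (accBasis 2) (fun y : Fin N → Bool => npow (matRd n N y) j i a)
      (2 * c + 1) ((SP c).eval n) := fun j => by
    have hjc : (j : ℕ) ≤ c := Nat.lt_succ_iff.mp j.isLt
    exact (acRealOver_npow hmat j i a).mono (by omega) (SP_eval_mono n hjc)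
  refine ((acRealOver_parity hj).mono (by omega) ?_).congr fun y => rfl
  rw [SM_eval]

/-- the §11 composition layer over matrix entries realised at depth `dm`, size `sm`: depth `dm + 4`, size `n³ (8 sm + 7) + 1`. -/
theorem acRealOver_redTabM {n N dm sm : ℕ} {Mf : (Fin N → Bool) → Fin n → Fin n → Bool}
    (hoff : ∀ k : Fin (tabN n), off n + pos n k < N) (hM : ∀ a b : Fin n, ACRealOver (accBasis 2) (fun y => Mf y a b) dm sm)
    (hdm : 1 ≤ dm) (hsm : 1 ≤ sm) (k : Fin (tabN n)) :
    ACRealOver (accBasis 2) (fun y : Fin N → Bool => redTab n (Mf y) (rd n fun i => ext y (off n + i)) k)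
      (dm + 4) (triN n * (8 * sm + 7) + 1) := by
  have hT : ∀ k' : Fin (tabN n), ACRealOver (accBasis 2) (fun y : Fin N → Bool => rd n (fun i => ext y (off n + i)) k') 1 1 :=
    fun k' => (acRealOver_evalLit 2 (Sum.inr (pol n k', ⟨off n + pos n k', hoff k'⟩) : Lit N)).congr fun y => by
      show xor (pol n k') (y ⟨off n + pos n k', hoff k'⟩) = xor (pol n k') (ext y (off n + pos n k'))
      rw [Theorems.FlatDial.ext, dif_pos (hoff k')]
  have hbig : 1 ≤ triN n * (8 * sm + 7) + 1 := Nat.le_add_left 1 _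
  obtain ⟨⟨b, o⟩, rfl⟩ := (tabEquiv n).surjective k
  cases b with
  | false =>
    rcases o with _ | ⟨a, b', c⟩
    · exact ((hT (tabEquiv n (false, none))).mono (by omega) hbig).congr fun y => by
        simp only [redTab, Equiv.symm_apply_apply]
    · exact ((hT (tabEquiv n (false, some (a, b', c)))).mono (by omega) hbig).congr fun y => by
        simp only [redTab, Equiv.symm_apply_apply]
  | true =>
    rcases o with _ | ⟨a, b', c⟩
    · exact ((hT (tabEquiv n (true, none))).mono (by omega) hbig).congr fun y => by
        simp only [redTab, Equiv.symm_apply_apply]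
    · have hterm : ∀ m : Fin (triN n), ACRealOver (accBasis 2) (fun y : Fin N → Bool =>
          compTerm (fun i j l => rd n (fun i' => ext y (off n + i')) (tabEquiv n (true, some (i, j, l))))
            (Mf y) a b' c ((triEquiv n).symm m)) (dm + 3) (8 * sm + 7) := fun m =>
        ((acRealOver_and2 (acRealOver_and2 (acRealOver_and2 ((hT _).mono hdm hsm) (hM _ _))
          ((hM _ _).mono (by omega) (by omega))) ((hM _ _).mono (by omega) (by omega))).mono (by omega) (by omega)).congr
          fun y => rfl
      exact (acRealOver_parity hterm).congr fun y => by simp only [redTab, Equiv.symm_apply_apply, compAt]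

open Classical in
/-- ★ THE STRING-LEVEL FAMILY for index `c + 1`: read `L`, invert it (`Σ_{j≤c} N^j`), form the tables of `(F, G ∘ L⁻¹)`, apply `D n`. -/
def strFunK (D : (n : ℕ) → (Fin (tabN n) → Bool) → Bool) (c N : ℕ) (y : Fin N → Bool) : Bool :=
  if h : ∃ n, tlen n = N then
    D (Classical.choose h) (redTab (Classical.choose h) (minv (matRd (Classical.choose h) N y) c)
      (rd (Classical.choose h) fun i => ext y (off (Classical.choose h) + i)))
  else false
/-- CouplingDialIndex helper `strFunK_encode` (decomp-qadv land package; see the module docstring). -/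
theorem strFunK_encode (D : (n : ℕ) → (Fin (tabN n) → Bool) → Bool) (c : ℕ) (I : CTriple) :
    strFunK D c I.encode.length I.encode.get = D I.n (tabOf ⟨I.n, I.F, compL I.G (minv I.L c)⟩) := by
  have h : ∃ n, tlen n = I.encode.length := ⟨I.n, (length_encode I).symm⟩
  rw [strFunK, dif_pos h]
  have hn : Classical.choose h = I.n := tlen_injective ((Classical.choose_spec h).trans (length_encode I))
  rw [hn, matRd_encode, rd_encode, redTab_tabOf]
/-- per-coordinate size of the index-`c+1` layer and the size polynomial of the string family. -/
def ZP (c : ℕ) : Polynomial ℕ := Polynomial.X ^ 3 * (8 * SM c + 7) + 1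
/-- CouplingDialIndex helper `ZP_eval` (decomp-qadv land package; see the module docstring). -/
theorem ZP_eval (c n : ℕ) : (ZP c).eval n = n ^ 3 * (8 * (SM c).eval n + 7) + 1 := by simp [ZP]
/-- CouplingDialIndex helper `kPoly` (decomp-qadv land package; see the module docstring). -/
def kPoly (c : ℕ) (r : Polynomial ℕ) : Polynomial ℕ := r + 2 * (Polynomial.X ^ 3 + 1) * ZP c
/-- CouplingDialIndex helper `kPoly_eval` (decomp-qadv land package; see the module docstring). -/
theorem kPoly_eval (c : ℕ) (r : Polynomial ℕ) (N : ℕ) : (kPoly c r).eval N = r.eval N + 2 * (N ^ 3 + 1) * (ZP c).eval N := by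
  simp [kPoly]
/-- ★ The index-`c+1` string family is `AC⁰[⊕]`: depth `d + (2c + 6)`, size `kPoly c r`. -/
theorem acRealOver_strFunK {D : (n : ℕ) → (Fin (tabN n) → Bool) → Bool} {d : ℕ} {r : Polynomial ℕ}
    (hD : ∀ n, ACRealOver (accBasis 2) (D n) d (r.eval n)) (c N : ℕ) :
    ACRealOver (accBasis 2) (strFunK D c N) (d + (2 * c + 6)) ((kPoly c r).eval N) := by
  rw [kPoly_eval]
  by_cases h : ∃ n, tlen n = N
  · have hN : tlen (Classical.choose h) = N := Classical.choose_spec h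
    set n := Classical.choose h with hn
    have hnN : n ≤ N := (le_clen n).trans (by rw [← hN]; unfold tlen; omega)
    have hoff : ∀ k : Fin (tabN n), off n + pos n k < N := fun k => by
      have := pos_lt_clen n k; rw [← hN]; unfold tlen off; omega
    have hmat : ∀ a b : Fin n, 2 * ((finProdFinEquiv (a, b) : Fin (n * n)) : ℕ) < N := fun a b => by
      have := (finProdFinEquiv (a, b) : Fin (n * n)).isLt; rw [← hN]; unfold tlen; omega
    have hSM : 1 ≤ (SM c).eval n := by rw [SM_eval]; exact Nat.le_add_left 1 _
    have hc := (hD n).comp fun k =>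
      acRealOver_redTabM (Mf := fun y => minv (matRd n N y) c) hoff (fun a b => acRealOver_minv hmat c a b) (by omega) hSM k
    refine (hc.mono (by omega) ?_).congr fun y => ?_
    · rw [sum_const, card_univ, Fintype.card_fin, smul_eq_mul, tabN_eq, triN_eq]
      simp only [ZP_eval]
      have h3 : n ^ 3 ≤ N ^ 3 := Nat.pow_le_pow_left hnN 3
      have hS : (SM c).eval n ≤ (SM c).eval N := natPoly_eval_mono _ hnN
      exact Nat.add_le_add (natPoly_eval_mono r hnN)
        (Nat.mul_le_mul (by omega) (Nat.add_le_add_right (Nat.mul_le_mul h3 (by omega)) 1))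
    · rw [strFunK, dif_pos h]
  · have h1 : 1 ≤ (ZP c).eval N := by rw [ZP_eval]; exact Nat.le_add_left 1 _
    refine ((acRealOver_const (acBasis_subset_accBasis 2) false).mono (by omega) ?_).congr fun y => ?_
    · have h0 : 0 < 2 * (N ^ 3 + 1) * (ZP c).eval N := by positivity
      exact le_add_left (Nat.succ_le_of_lt h0)
    · rw [strFunK, dif_neg h]

/-! ### 12c `N_{c+1} ⟺ T` -/
/-- ★★ A TABLE-LEVEL SIGNER OF THE SOLO SLICE PUTS EVERY BOUNDED-INDEX SLICE IN promise-`AC⁰[⊕]`. -/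
theorem nilSlice_const_mem_of_signer (c : ℕ) {D : (n : ℕ) → (Fin (tabN n) → Bool) → Bool} (hr : D ∈ realisable)
    (hs : D ∈ signers) : NilSlice (fun _ => c + 1) ∈ promiseLift (AC0Mod 2) := by
  obtain ⟨d, r, hD⟩ := hr
  choose C hC using fun N => (acRealOver_strFunK hD c N).toCircuit
  have key : ∀ I : CTriple, strFunK D c I.encode.length I.encode.get = D I.n (tabOf ⟨I.n, I.F, compL I.G (minv I.L c)⟩) :=
    fun I => strFunK_encode D c I
  have hval : ∀ I : CTriple, Unipotent I.L (c + 1) →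
      (pairOf I.n (tabOf ⟨I.n, I.F, compL I.G (minv I.L c)⟩)).value = I.cvalue := fun I hu => by
    rw [pairOf_tabOf ⟨I.n, I.F, compL I.G (minv I.L c)⟩]
    exact value_compL_of_inverse I (minv I.L c) (mv_mul_minv hu) (mv_minv_mul hu)
  refine ⟨{x | strFunK D c x.length x.get = true}, ⟨d + (2 * c + 6), kPoly c r, C,
    fun N => ⟨(hC N).1, (hC N).2.1, (hC N).2.2.1⟩, fun x => ?_⟩, ?_, ?_⟩
  · rw [(hC x.length).2.2.2 x.get]
    cases hx : strFunK D c x.length x.get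
    · symm; exact (Set.notMem_iff_boolIndicator _ _).1 (by simp [hx])
    · symm; exact (Set.mem_iff_boolIndicator _ _).1 (by simpa using hx)
  · rintro x ⟨I, ⟨hev, hu, hv⟩, rfl⟩
    show strFunK D c I.encode.length I.encode.get = true
    rw [key I]
    exact (hs I.n _ hev).1 ((hval I hu).trans hv)
  · rintro x ⟨I, ⟨hev, hu, hv⟩, rfl⟩
    show ¬ strFunK D c I.encode.length I.encode.get = true
    rw [key I, (hs I.n _ hev).2 ((hval I hu).trans hv)]
    exact Bool.false_ne_true
/-- ★★ `N_{c+1} ⟹ T`. -/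
theorem rungANonuniform_of_constNilRung (c : ℕ) : ConstNilRung c → RungANonuniform := by
  intro hc
  by_contra hT
  have hex : ∃ D : (n : ℕ) → (Fin (tabN n) → Bool) → Bool, D ∈ realisable ∧ D ∈ signers := by
    by_contra hne
    exact hT (signedSlice_not_mem_promiseLift_iff_no_signer.mpr hne)
  obtain ⟨D, hr, hs⟩ := hex
  exact hc (nilSlice_const_mem_of_signer c hr hs)
/-- ★★★ `N_{c+1} ⟺ T` FOR EVERY CONSTANT `c`, IN KERNEL. -/
theorem constNilRung_iff (c : ℕ) : ConstNilRung c ↔ RungANonuniform :=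
  ⟨rungANonuniform_of_constNilRung c, constNilRung_of_rungANonuniform c⟩
/-- the ladder after rev 4: `T ⟺ N_k` for every constant `k ≥ 1`; `T ⟹ W′ = N_{log n+1}`; `N_{n/6}` THEOREM. -/
theorem dial_summary_rev4 :
    (∀ c, RungANonuniform ↔ ConstNilRung c) ∧ (RungANonuniform → LogNilRung) ∧ NilRung (fun n => n / 6) :=
  ⟨fun c => (constNilRung_iff c).symm, logNilRung_of_rungANonuniform, nilRung_sixth⟩

end IndexConst

end Summit.QuantumAdvantage.QuantumAdvantage.Theorems.CouplingDial

end
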